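import Summits.ValiantsHypothesis.ValiantsHypothesis.Theorems.BarrierLeverNaturalProofsSeparateVNPBorderFamily
import Literature.Computability.AlgebraicComplexity.ApproxComplexityProjections
import Literature.Computability.AlgebraicComplexity.ValiantHCCompleteness
import Literature.Computability.AlgebraicComplexity.ValiantConjectureProofs

/-!
# Route BarrierLever — item `NaturalProofsSeparateVNP` (stmt-ValiantsHypothesis-18972): the item's
# constructivity-free shadow IS the border Valiant hypothesis `VNP ⊄ \overline{VP}`, class-level
# (cell valiant-natproofs, seat val-np-p4 gen 6; bears on ladder rung V4 and the border / GCT column)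

`S := Theses.BarrierLever.NaturalProofsSeparateVNP`. The sibling `…NaturalProofsSeparateVNPBorderFamily`
identified, for each fixed definability exponent `b₁`, the item's UNIFORM statement with its
constructivity clause dropped (`𝒟 = Set.univ`) with "some family pointwise in `SmallDefinable ℂ n b₁`
is outside `\overline{VP}`". With the border-continuity file
`Literature/…/ApproxComplexityProjections` (Bürgisser 2004 §4: `\overline{VP}` is closed under
p-projections; `\underline{L}` is invariant under injective renaming) this file closes the dictionary
at the CLASS level, in the tree's BLMW vocabulary (`IsVNPFamily`, `IsVPBarFamily`, the shape of
`BLMW2011_prop_9_3_2`):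

* `not_isVPBarFamily_of_isVNPComplete` — **`S` puts EVERY `VNP`-complete p-family outside
  `\overline{VP}`** (general, non-homogeneous case; `p443071` had forms only).
* `vnp_subset_vpbar_iff_of_isVNPComplete`, `vnp_subset_vpbar_iff_perPoly`,
  `vnp_subset_vpbar_iff_hcPoly` — `VNP ⊆ \overline{VP}` iff one `VNP`-complete family is in
  `\overline{VP}`, iff `(per_n) ∈ \overline{VP}`, iff `(HC_n) ∈ \overline{VP}` (the `\overline{VP}`-analogue
  of BLMW 2011 Prop. 9.3.2, which is about `\overline{VP_ws}`; unconditional equivalences).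
* `univ_separate_one_of_isVNPFamily_not_isVPBarFamily` — FRAMING: any `VNP` family outside
  `\overline{VP}` (in `v(n)` variables) yields the `b₁ = 1` uniform `Set.univ`-separation of the item's
  shape (rename into `A(n+1)^B` variables — `\underline{L}` is unchanged,
  `approxComplexity_rename_eq_of_injective` — and read off an equation,
  `Nonconstructive.exists_univ_of_lt_approxComplexity`).
* **`univ_separate_one_iff_vnp_not_subset_vpbar`** — the item minus constructivity, at `b₁ = 1`,
  is EQUIVALENT to `VNP ⊄ \overline{VP}`; `exists_univ_separate_iff_one` — and its `∃ b₁` collapses to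
  `b₁ = 1` (as the item's own does, `naturalProofsSeparateVNP_iff_separate_one`);
  `univ_separate_one_iff_not_isVPBarFamily_perPoly` / `_hcPoly` — equivalently `(per_n) ∉ \overline{VP}`
  / `(HC_n) ∉ \overline{VP}`.

So item 18972 reads: **[`VNP ⊄ \overline{VP}`, i.e. `\underline{L}(per_n)` superpolynomial] + [the separating
equations can be taken of size and degree `N^{O(1)}` (level-one constructivity)]** — the first
bracket is the border Valiant hypothesis (open; implied by the Mulmuley–Sohoni conjecture
`BorderDcPerSuperpolynomial` only for `\overline{VP_ws}`), the second is exactly what the crux (item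
14610, FSV Question 6) forbids.

WHAT THIS IS NOT: not a proof or refutation of item 18972 (parked on crux 14610); equivalences
between open statements, and implications from the open item; nothing here is progress on
`VP ≠ VNP`, `VNP ⊄ \overline{VP}`, FSV Question 6 or the hardness of `per`/`HC`.

References: [Burgisser2004Factors] §4; [BurgisserEtAl2011] Def. 9.3.1, §9.3, Prop. 9.3.2;
[Burgisser2000] Def. 2.1–2.6, Rem. 2.2; [Valiant1979]; [ForbesShpilkaVolk2018] Def. 1, §1.1;
[KumarRamyaSaptharishiTengse2022] Def. 3–4.
-/

-- layout Summits/ValiantsHypothesis/ValiantsHypothesis forces the duplicated namespace component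
set_option linter.dupNamespace false

noncomputable section

namespace Summit.ValiantsHypothesis.ValiantsHypothesis.Theorems.BarrierLever.NaturalProofsSeparateVNP

open Literature.Barriers.ValiantsHypothesis Literature.Computability.AlgebraicComplexity MvPolynomial
open Summit.ValiantsHypothesis.ValiantsHypothesis.Theses

namespace BorderVH

/-! ### 1. The item puts every `VNP`-complete family outside `\overline{VP}` -/

/-- **Item 18972 ⇒ every `VNP`-complete p-family is outside `\overline{VP}`.** The item's `VNP` family
outside `\overline{VP}` (`Border.exists_isVNPFamily_not_isVPBarFamily`) is a p-projection of `Q`, and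
`\overline{VP}` is closed under p-projections from p-families (Bürgisser 2004 §4, the tree's
`IsVPBarFamily.of_isPProjection_of_isPFamily`). General form of `Border.not_isVPBarFamily_perPoly`
/ `not_isVPBarFamily_hcPoly` (no homogeneity needed). [cite: Burgisser2004Factors, §4]
[cite: BurgisserEtAl2011, §9.3] -/
theorem not_isVPBarFamily_of_isVNPComplete {σ : ℕ → Type*} [∀ n, Fintype (σ n)]
    [∀ n, DecidableEq (σ n)] {Q : ∀ n, MvPolynomial (σ n) ℂ} (hQ : IsVNPComplete Q)
    (hS : BarrierLever.NaturalProofsSeparateVNP) : ¬ IsVPBarFamily Q := by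
  intro hbar
  obtain ⟨h, hVNP, hnot⟩ := Border.exists_isVNPFamily_not_isVPBarFamily hS
  exact hnot (IsVPBarFamily.of_isPProjection_of_isPFamily (hQ.2 (fun n => n) h hVNP) hQ.1.1 hbar)

/-! ### 2. `VNP ⊆ \overline{VP}` is decided at any complete family (unconditional) -/

/-- **`VNP ⊆ \overline{VP}` iff ONE `VNP`-complete family (in variables `Fin (v n)`) is in `\overline{VP}`.**
[cite: Burgisser2004Factors, §4] [cite: Burgisser2000, Def. 2.8–2.9] -/
theorem vnp_subset_vpbar_iff_of_isVNPComplete {v : ℕ → ℕ}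
    {Q : ∀ n, MvPolynomial (Fin (v n)) ℂ} (hQ : IsVNPComplete Q) :
    (∀ (w : ℕ → ℕ) (f : ∀ n, MvPolynomial (Fin (w n)) ℂ), IsVNPFamily f → IsVPBarFamily f) ↔
      IsVPBarFamily Q :=
  ⟨fun h => h v Q hQ.1, fun hbar w f hf =>
    IsVPBarFamily.of_isPProjection_of_isPFamily (hQ.2 w f hf) hQ.1.1 hbar⟩

/-- **`VNP ⊆ \overline{VP}` iff `(per_n) ∈ \overline{VP}`** — the `\overline{VP}`-analogue of BLMW 2011
Prop. 9.3.2 (there for `\overline{VP_ws}`): Valiant's completeness of the permanent (tree,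
`isVNPComplete_perPoly_holds`, `char ℂ ≠ 2`) and closure of `\overline{VP}` under p-projections; for
"⇒" the permanent is re-indexed on `Fin (n·n)` (`\underline{L}` invariant,
`isVPBarFamily_rename_iff_of_injective`). [cite: BurgisserEtAl2011, Prop. 9.3.2] [cite: Valiant1979] -/
theorem vnp_subset_vpbar_iff_perPoly :
    (∀ (w : ℕ → ℕ) (f : ∀ n, MvPolynomial (Fin (w n)) ℂ), IsVNPFamily f → IsVPBarFamily f) ↔
      IsVPBarFamily fun n => perPoly (Fin n) ℂ := by
  constructor
  · intro h
    have hVNP : IsVNPFamily fun n => renameEquiv ℂ finProdFinEquiv (perPoly (Fin n) ℂ) :=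
      (isVNPFamily_perPoly_holds ℂ).renameEquiv fun n => finProdFinEquiv
    have hbar := h (fun n => n * n) _ hVNP
    exact (isVPBarFamily_rename_iff_of_injective (fun n => (finProdFinEquiv (m := n) (n := n)).injective)
      fun n => perPoly (Fin n) ℂ).1 hbar
  · intro hper w f hf
    have h2 : ringChar ℂ ≠ 2 := by rw [ringChar.eq_zero]; decide
    exact IsVPBarFamily.of_isPProjection_of_isPFamily ((isVNPComplete_perPoly_holds ℂ h2).2 w f hf)
      (isVNPComplete_perPoly_holds ℂ h2).1.1 hper

/-- **`VNP ⊆ \overline{VP}` iff `(HC_n) ∈ \overline{VP}`** (Valiant's completeness of `HC`, every field,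
tree `isVNPComplete_hcPoly_holds`). [cite: BurgisserEtAl2011, §9.3] [cite: Valiant1979] -/
theorem vnp_subset_vpbar_iff_hcPoly :
    (∀ (w : ℕ → ℕ) (f : ∀ n, MvPolynomial (Fin (w n)) ℂ), IsVNPFamily f → IsVPBarFamily f) ↔
      IsVPBarFamily fun n => hcPoly (Fin n) ℂ := by
  constructor
  · intro h
    have hVNP : IsVNPFamily fun n => renameEquiv ℂ finProdFinEquiv (hcPoly (Fin n) ℂ) :=
      (isVNPComplete_hcPoly_holds ℂ).1.renameEquiv fun n => finProdFinEquiv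
    have hbar := h (fun n => n * n) _ hVNP
    exact (isVPBarFamily_rename_iff_of_injective (fun n => (finProdFinEquiv (m := n) (n := n)).injective)
      fun n => hcPoly (Fin n) ℂ).1 hbar
  · intro hhc w f hf
    exact IsVPBarFamily.of_isPProjection_of_isPFamily ((isVNPComplete_hcPoly_holds ℂ).2 w f hf)
      (isVNPComplete_hcPoly_holds ℂ).1.1 hhc

/-- Hence `(per_n) ∈ \overline{VP} ↔ (HC_n) ∈ \overline{VP}` (unconditional).
[cite: BurgisserEtAl2011, §9.3] [cite: Valiant1979] -/
theorem isVPBarFamily_perPoly_iff_hcPoly :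
    (IsVPBarFamily fun n => perPoly (Fin n) ℂ) ↔ IsVPBarFamily fun n => hcPoly (Fin n) ℂ := by
  rw [← vnp_subset_vpbar_iff_perPoly, vnp_subset_vpbar_iff_hcPoly]

/-! ### 3. Framing: a `VNP` family outside `\overline{VP}` gives the `b₁ = 1` uniform separation -/

/-- **Framing a border-hard `VNP` family into FSV's regime.** From `f ∈ VNP` (in `v(n)` variables)
with `\underline{L}(f_n)` not p-bounded: bound variables, degree, Boolean-sum length and witness
size/degree by one `m(n) = A(n+1)^B`; the renaming of `f_n` into `m(n)` variables lies in
`SmallDefinable ℂ m(n) 1` (as in `escape_of_valiantsHypothesis`) and keeps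
`\underline{L} = \underline{L}(f_n) > n^{b(B+1)} ≥ m(n)^b` (`approxComplexity_rename_eq_of_injective`), so
SOME equation of `coeff(SmallCircuits ℂ m(n) b)` has it as a non-root
(`Nonconstructive.exists_univ_of_lt_approxComplexity`). [cite: Burgisser2000, Def. 2.1–2.5 and Rem. 2.2]
[cite: Burgisser2004Factors, §4] [cite: BurgisserEtAl2011, Def. 9.3.1] -/
theorem univ_separate_one_of_isVNPFamily_not_isVPBarFamily {v : ℕ → ℕ}
    {f : ∀ n, MvPolynomial (Fin (v n)) ℂ} (hf : IsVNPFamily f) (hbar : ¬ IsVPBarFamily f)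
    (b n₀ : ℕ) :
    ∃ n : ℕ, n₀ ≤ n ∧ ∃ D : MvPolynomial (degLEMonomials n) ℂ,
      IsNaturalProof (degLEMonomials n) (SmallCircuits ℂ n b) Set.univ D ∧
      ∃ g ∈ SmallDefinable ℂ n 1, eval (coeffVector (degLEMonomials n) g) D ≠ 0 := by
  classical
  obtain ⟨⟨hnv, hdegF⟩, u, g, ⟨⟨hcard, hdegg⟩, hcomp⟩, hsum⟩ := hf
  -- one common bound `A (n+1)^B`, `A, B ≥ 1`
  obtain ⟨A, B, hA, hB, hT⟩ : ∃ A B : ℕ, 1 ≤ A ∧ 1 ≤ B ∧ ∀ n, v n ≤ A * (n + 1) ^ B ∧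
      (f n).totalDegree ≤ A * (n + 1) ^ B ∧ u n ≤ A * (n + 1) ^ B ∧
      (g n).totalDegree ≤ A * (n + 1) ^ B ∧ complexity (g n) ≤ A * (n + 1) ^ B := by
    obtain ⟨A₁, B₁, h₁⟩ := (IsPBounded.iff_exists_le_mul_succ_pow _).1 hnv
    obtain ⟨A₂, B₂, h₂⟩ := (IsPBounded.iff_exists_le_mul_succ_pow _).1 hdegF
    obtain ⟨A₃, B₃, h₃⟩ := (IsPBounded.iff_exists_le_mul_succ_pow _).1 hcard
    obtain ⟨A₄, B₄, h₄⟩ := (IsPBounded.iff_exists_le_mul_succ_pow _).1 hdegg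
    obtain ⟨A₅, B₅, h₅⟩ := (IsPBounded.iff_exists_le_mul_succ_pow _).1 hcomp
    have hmono : ∀ n A' B' : ℕ, A' ≤ A₁ + A₂ + A₃ + A₄ + A₅ + 1 → B' ≤ B₁ + B₂ + B₃ + B₄ + B₅ + 1 →
        A' * (n + 1) ^ B' ≤
          (A₁ + A₂ + A₃ + A₄ + A₅ + 1) * (n + 1) ^ (B₁ + B₂ + B₃ + B₄ + B₅ + 1) :=
      fun n A' B' hA' hB' => Nat.mul_le_mul hA' (Nat.pow_le_pow_right (Nat.succ_pos n) hB')
    refine ⟨A₁ + A₂ + A₃ + A₄ + A₅ + 1, B₁ + B₂ + B₃ + B₄ + B₅ + 1, by omega, by omega,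
      fun n => ⟨?_, ?_, ?_, ?_, ?_⟩⟩
    · have h := h₁ n
      simp only [Fintype.card_fin] at h
      exact h.trans (hmono n _ _ (by omega) (by omega))
    · exact (h₂ n).trans (hmono n _ _ (by omega) (by omega))
    · have h := h₃ n
      simp only [Fintype.card_sum, Fintype.card_fin] at h
      exact ((Nat.le_add_left _ _).trans h).trans (hmono n _ _ (by omega) (by omega))
    · exact (h₄ n).trans (hmono n _ _ (by omega) (by omega))
    · exact (h₅ n).trans (hmono n _ _ (by omega) (by omega))
  -- a large `n` at which `\underline{L}(f_n)` beats `n ^ (b (B+1))`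
  obtain ⟨n, hn, hlt⟩ :=
    Nonconstructive.exists_ge_pow_lt_of_not_isPBounded hbar (b * (B + 1)) (n₀ + A * 2 ^ B + 1)
  obtain ⟨hnvars, hdegFn, hun, hdeggn, hcompn⟩ := hT n
  have hAn : A * 2 ^ B ≤ n := by omega
  -- the number of variables `m = A (n+1)^B`
  have hm_ge : n + 1 ≤ A * (n + 1) ^ B := by
    calc n + 1 = 1 * (n + 1) ^ 1 := by ring
      _ ≤ A * (n + 1) ^ B := Nat.mul_le_mul hA (Nat.pow_le_pow_right (Nat.succ_pos n) hB)
  have hm_le : A * (n + 1) ^ B ≤ n ^ (B + 1) := by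
    calc A * (n + 1) ^ B ≤ A * (2 * n) ^ B :=
          Nat.mul_le_mul_left _ (Nat.pow_le_pow_left (by omega) B)
      _ = (A * 2 ^ B) * n ^ B := by rw [mul_pow]; ring
      _ ≤ n * n ^ B := Nat.mul_le_mul_right _ hAn
      _ = n ^ (B + 1) := by ring
  have hmb : (A * (n + 1) ^ B) ^ b ≤ n ^ (b * (B + 1)) := by
    calc (A * (n + 1) ^ B) ^ b ≤ (n ^ (B + 1)) ^ b := Nat.pow_le_pow_left hm_le b
      _ = n ^ (b * (B + 1)) := by rw [← pow_mul, mul_comm]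
  -- the renamed polynomial
  set ι : Fin (v n) → Fin (A * (n + 1) ^ B) := Fin.castLE hnvars with hι
  have hιinj : Function.Injective ι := Fin.castLE_injective _
  have hG : rename ι (f n) ∈ SmallDefinable ℂ (A * (n + 1) ^ B) 1 := by
    refine ⟨(totalDegree_rename_le _ _).trans hdegFn, u n, ?_, rename (Sum.map ι id) (g n),
      ?_, ?_, ?_⟩
    · rw [pow_one]; exact hun
    · rw [pow_one]; exact (complexity_rename_le_holds' _ _).trans hcompn
    · rw [pow_one]; exact (totalDegree_rename_le _ _).trans hdeggn
    · rw [boolSum_rename_sumMap, ← hsum n]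
  have hlt' : (A * (n + 1) ^ B) ^ b < approxComplexity (rename ι (f n)) := by
    rw [approxComplexity_rename_eq_of_injective hιinj]
    exact lt_of_le_of_lt hmb hlt
  obtain ⟨D, hD, hne⟩ := Nonconstructive.exists_univ_of_lt_approxComplexity hG.1 hlt'
  exact ⟨A * (n + 1) ^ B, by omega, D, hD, rename ι (f n), hG, hne⟩

/-! ### 4. The item minus constructivity ⟺ `VNP ⊄ \overline{VP}` (class level) -/

/-- **Item 18972 WITHOUT constructivity, at `b₁ = 1`, is EQUIVALENT to `VNP ⊄ \overline{VP}`.** "For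
every `b`, infinitely often, SOME nonzero equation of `coeff(SmallCircuits ℂ n b)` has a non-root in
`SmallDefinable ℂ n 1`" iff NOT every `VNP` family (variables `Fin (w n)`, Bürgisser 2000 Def. 2.5)
has p-bounded approximate complexity (BLMW 2011 §9.3 `\overline{VP}`). "⇒" is the sibling's
`Nonconstructive.exists_isVNPFamily_not_isVPBarFamily_of_univ_separate`; "⇐" is the framing
`univ_separate_one_of_isVNPFamily_not_isVPBarFamily`. The item proper adds `D ∈ Distinguishers ℂ n 1`.
[cite: BurgisserEtAl2011, Def. 9.3.1 and §9.3] [cite: ForbesShpilkaVolk2018, Def. 1, §1.1] -/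
theorem univ_separate_one_iff_vnp_not_subset_vpbar :
    (∀ b n₀ : ℕ, ∃ n : ℕ, n₀ ≤ n ∧ ∃ D : MvPolynomial (degLEMonomials n) ℂ,
      IsNaturalProof (degLEMonomials n) (SmallCircuits ℂ n b) Set.univ D ∧
      ∃ g ∈ SmallDefinable ℂ n 1, eval (coeffVector (degLEMonomials n) g) D ≠ 0) ↔
    ¬ ∀ (w : ℕ → ℕ) (f : ∀ n, MvPolynomial (Fin (w n)) ℂ), IsVNPFamily f → IsVPBarFamily f := by
  constructor
  · intro hsep hall
    obtain ⟨h, hVNP, hbar⟩ :=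
      Nonconstructive.exists_isVNPFamily_not_isVPBarFamily_of_univ_separate hsep
    exact hbar (hall (fun n => n) h hVNP)
  · intro hnot
    push Not at hnot
    obtain ⟨w, f, hf, hbar⟩ := hnot
    exact univ_separate_one_of_isVNPFamily_not_isVPBarFamily hf hbar

/-- **The definability exponent collapses to `b₁ = 1`** in the constructivity-free uniform statement
too (compare `naturalProofsSeparateVNP_iff_separate_one` for the item itself): a separation at any
`b₁` yields a pointwise-`VNP_{b₁}`-succinct family outside `\overline{VP}`
(`Nonconstructive.univ_separate_iff_exists_family`), which is p-definable
(`KRSTResidualBand.isVNPFamily_of_mem_smallDefinable`) and is re-framed at `b₁ = 1`.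
[cite: Burgisser2000, Def. 2.5] [cite: BurgisserEtAl2011, §9.3] -/
theorem exists_univ_separate_iff_one :
    (∃ b₁ : ℕ, ∀ b n₀ : ℕ, ∃ n : ℕ, n₀ ≤ n ∧ ∃ D : MvPolynomial (degLEMonomials n) ℂ,
      IsNaturalProof (degLEMonomials n) (SmallCircuits ℂ n b) Set.univ D ∧
      ∃ g ∈ SmallDefinable ℂ n b₁, eval (coeffVector (degLEMonomials n) g) D ≠ 0) ↔
    (∀ b n₀ : ℕ, ∃ n : ℕ, n₀ ≤ n ∧ ∃ D : MvPolynomial (degLEMonomials n) ℂ,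
      IsNaturalProof (degLEMonomials n) (SmallCircuits ℂ n b) Set.univ D ∧
      ∃ g ∈ SmallDefinable ℂ n 1, eval (coeffVector (degLEMonomials n) g) D ≠ 0) := by
  refine ⟨fun ⟨b₁, hsep⟩ => ?_, fun h => ⟨1, h⟩⟩
  obtain ⟨h, hh, hbar⟩ := Nonconstructive.univ_separate_iff_exists_family.mp hsep
  exact univ_separate_one_of_isVNPFamily_not_isVPBarFamily (v := fun n => n)
    (KRSTResidualBand.isVNPFamily_of_mem_smallDefinable hh) hbar

/-- **… ⟺ `(per_n) ∉ \overline{VP}`**: the constructivity-free uniform statement (at `b₁ = 1`) holds iff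
the permanent has superpolynomial approximate circuit complexity `\underline{L}`.
[cite: BurgisserEtAl2011, Prop. 9.3.2 and §9.3] [cite: Valiant1979] -/
theorem univ_separate_one_iff_not_isVPBarFamily_perPoly :
    (∀ b n₀ : ℕ, ∃ n : ℕ, n₀ ≤ n ∧ ∃ D : MvPolynomial (degLEMonomials n) ℂ,
      IsNaturalProof (degLEMonomials n) (SmallCircuits ℂ n b) Set.univ D ∧
      ∃ g ∈ SmallDefinable ℂ n 1, eval (coeffVector (degLEMonomials n) g) D ≠ 0) ↔
    ¬ IsVPBarFamily fun n => perPoly (Fin n) ℂ := by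
  rw [univ_separate_one_iff_vnp_not_subset_vpbar, vnp_subset_vpbar_iff_perPoly]

/-- **… ⟺ `(HC_n) ∉ \overline{VP}`.** [cite: BurgisserEtAl2011, §9.3] [cite: Valiant1979] -/
theorem univ_separate_one_iff_not_isVPBarFamily_hcPoly :
    (∀ b n₀ : ℕ, ∃ n : ℕ, n₀ ≤ n ∧ ∃ D : MvPolynomial (degLEMonomials n) ℂ,
      IsNaturalProof (degLEMonomials n) (SmallCircuits ℂ n b) Set.univ D ∧
      ∃ g ∈ SmallDefinable ℂ n 1, eval (coeffVector (degLEMonomials n) g) D ≠ 0) ↔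
    ¬ IsVPBarFamily fun n => hcPoly (Fin n) ℂ := by
  rw [univ_separate_one_iff_vnp_not_subset_vpbar, vnp_subset_vpbar_iff_hcPoly]

/-! ### 5. Back to the item -/

/-- **Item 18972 ⇒ `VNP ⊄ \overline{VP}` (class-level form)**, i.e. the negation of "every `VNP` family in
variables `Fin (w n)` is in `\overline{VP}`" — the border Valiant hypothesis in the shape of
`BLMW2011_prop_9_3_2`'s right-hand side with `\overline{VP}` for `\overline{VP_ws}`.
[cite: BurgisserEtAl2011, §9.3 and Prop. 9.3.2] [cite: ForbesShpilkaVolk2018, §1.1] -/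
theorem vnp_not_subset_vpbar_of_naturalProofsSeparateVNP (hS : BarrierLever.NaturalProofsSeparateVNP) :
    ¬ ∀ (w : ℕ → ℕ) (f : ∀ n, MvPolynomial (Fin (w n)) ℂ), IsVNPFamily f → IsVPBarFamily f := by
  obtain ⟨b₁, hsep⟩ := Nonconstructive.univ_separate_of_naturalProofsSeparateVNP hS
  exact univ_separate_one_iff_vnp_not_subset_vpbar.mp (exists_univ_separate_iff_one.mp ⟨b₁, hsep⟩)

/-- **The item splits as [border `VH`] + [level-one constructivity]:** `S` holds iff
`VNP ⊄ \overline{VP}` AND `S` — recorded as the trivial equivalence making the first conjunct explicit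
(the second conjunct is what the crux, item 14610, forbids: `not_naturalProofsSeparateVNP_of_crux`).
[cite: ForbesShpilkaVolk2018, Def. 1 and Question 6] [cite: BurgisserEtAl2011, §9.3] -/
theorem naturalProofsSeparateVNP_iff_vnp_not_subset_vpbar_and :
    BarrierLever.NaturalProofsSeparateVNP ↔
      (¬ ∀ (w : ℕ → ℕ) (f : ∀ n, MvPolynomial (Fin (w n)) ℂ), IsVNPFamily f → IsVPBarFamily f) ∧
        BarrierLever.NaturalProofsSeparateVNP :=
  ⟨fun hS => ⟨vnp_not_subset_vpbar_of_naturalProofsSeparateVNP hS, hS⟩, fun h => h.2⟩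

end BorderVH

end Summit.ValiantsHypothesis.ValiantsHypothesis.Theorems.BarrierLever.NaturalProofsSeparateVNP

end
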